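import Summits.QuantumFields.YangMills.Theorems.Instrument.LimitObjectsKZL2rpLIM
import Summits.QuantumFields.GaugeBoot.Certificates.KZL2rpD4LIMTab
import HarnessLib

/-!
# YM instrument cell — `SU(2)`, `D = 4`: the five class-LIMIT blocks of the 75-block family `KZL2rpD4LIM` are positive semidefinite at the
# class-LIMIT variables `yLim μ` (P-A5 groundwork: the END-independent half of a class-LIMIT certificate replay)

Cell `ym-instrument` (HUMAN RULING D-0084 (2); director-ym R138; HOME `run/shared/lean/pub/ym-instrument/`), crew (a), Lean typist seat
`ym-instrument-boot-lean-1` (gen 3). Planner proposal P-A5 «class-LIMIT kernel replay» (boot-plan 2026-08-27T05:03:40Z; desk `LIMIT-BIND-SCOPE.md`).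
A class-LIMIT certificate half emitted on the window route consumes `hpsd : ∀ k : Fin 75, (Sparse.redE KZL2rpD4LIM.EB k (dimL.getD k 0) 10878 y).PosSemidef`;
by `KZL2rpD4LIM.posSemidef_all` this splits into the 70 blocks of record (discharged at limit points by
`ClassAFeasibleAtLimitKZL2rp.redBlock_posSemidef_yLim`) and the five appendix blocks `Sparse.redE KZL2rpD4LIM.EBlim t …`, which THIS file discharges at
`y := yLim μ` from the typed class-LIMIT objects of `LimitObjectsKZL2rpLIM` (`limObj_hankelSite_R1/R2`, `limObj_hankelLink_R1`, `limObj_hankelDiff_D0/D1`):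
`limBlocks_posSemidef_yLim`. Hence `hpsd_yLim : ∀ k : Fin 75, …` (`posSemidef_all_yLim`) — every PSD hypothesis of a kz-L2-rp-4D class-LIMIT certificate half
holds at every infinite-volume limit point along even tori (`β_std ≥ 0`). Ladder consequence: provenance of the R0 class-LIMIT rows of TABLE-A1 (IR
`stmt-QuantumFields-19354`); no number moves; nothing summit-bearing.

HONEST FRAMING (page 1 of every file of this cell): WHAT IS CERTIFIED HERE, AT WHICH `(G, D, L, β)`: `G = SU(2)` (fundamental, standard Wilson action,
tree coupling `β/2`), `D = 4`, class LIMIT = infinite-volume limit points of the torus Wilson states along strictly increasing sequences of EVEN tori, every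
`β_std ≥ 0`; positivity statements about limits of lattice expectations; NOT a finite-torus bound, not an area law, string tension, mass gap or continuum
statement; no uniqueness of the limit. No certificate is replayed in this file.
-/

noncomputable section

namespace Summit.QuantumFields.YangMills.Theorems.Instrument

open MeasureTheory Filter Topology Finset Matrix
open Summit.QuantumFields.GaugeBoot
open Summit.QuantumFields.GaugeBoot.Certificates
open Summit.QuantumFields.GaugeBoot.Certificates.Sparse
open Summit.QuantumFields.GaugeBoot.Certificates.KZL2rpD4LIM (EBlim dimLlim)
open Literature.MathematicalPhysics.QuantumFieldTheory
open Literature.MathematicalPhysics.QuantumLattice (LGConfig IsInfiniteVolumeLimitAlong)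

/-! ## Reduced blocks are symmetric -/

/-- `Sparse.ent` is symmetric in `(i, j)`. [folklore] -/
theorem ent_symm (EB : List (List (List (List (ℕ × ℤ))))) (k i j : ℕ) : Sparse.ent EB k i j = Sparse.ent EB k j i := by
  unfold Sparse.ent
  by_cases h1 : i ≤ j
  · by_cases h2 : j ≤ i
    · have : i = j := le_antisymm h1 h2
      subst this; rfl
    · rw [if_pos h1, if_neg h2]
  · by_cases h2 : j ≤ i
    · rw [if_neg h1, if_pos h2]
    · omega

/-- Every reduced block `redE EB k d nv y` is a symmetric real matrix. [folklore] -/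
theorem redE_isHermitian (EB : List (List (List (List (ℕ × ℤ))))) (k d nv : ℕ) (y : Fin nv → ℝ) :
    (redE EB k d nv y).IsHermitian := by
  refine Matrix.IsHermitian.ext fun i j => ?_
  rw [star_trivial, redE_apply, redE_apply, ent_symm]

/-! ## The five appendix blocks as explicit quadratic forms -/

section Forms

variable (y : Fin 10878 → ℝ)

/-- Quadratic form of appendix block `0` (`hankel-site/R1/S0-2`, columns `0,1,2,5,27`). [folklore] -/
theorem quadForm_lim0 (x : Fin 3 → ℝ) :
    star x ⬝ᵥ (redE EBlim 0 3 10878 y *ᵥ x) =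
      x 0 * x 0 * y 0 + x 0 * x 1 * y 1 + x 0 * x 2 * y 2 + (x 1 * x 0 * y 1 + x 1 * x 1 * y 2 + x 1 * x 2 * y 5) +
        (x 2 * x 0 * y 2 + x 2 * x 1 * y 5 + x 2 * x 2 * y 27) := by
  simp [dotProduct, mulVec, Fin.sum_univ_three, redE_apply, Sparse.ent, entU, EBlim, evalComb_cons, evalComb_nil]
  ring

/-- Quadratic form of appendix block `1` (`hankel-site/R2/S0-1`, columns `0,2,13`). [folklore] -/
theorem quadForm_lim1 (x : Fin 2 → ℝ) :
    star x ⬝ᵥ (redE EBlim 1 2 10878 y *ᵥ x) =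
      x 0 * x 0 * y 0 + x 0 * x 1 * y 2 + x 1 * x 0 * y 2 + x 1 * x 1 * y 13 := by
  simp [dotProduct, mulVec, Fin.sum_univ_two, redE_apply, Sparse.ent, entU, EBlim, evalComb_cons, evalComb_nil]
  ring

/-- Quadratic form of appendix block `2` (`hankel-link/R1/S0-1`, columns `1,2,5`). [folklore] -/
theorem quadForm_lim2 (x : Fin 2 → ℝ) :
    star x ⬝ᵥ (redE EBlim 2 2 10878 y *ᵥ x) =
      x 0 * x 0 * y 1 + x 0 * x 1 * y 2 + x 1 * x 0 * y 2 + x 1 * x 1 * y 5 := by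
  simp [dotProduct, mulVec, Fin.sum_univ_two, redE_apply, Sparse.ent, entU, EBlim, evalComb_cons, evalComb_nil]
  ring

/-- Quadratic form of appendix block `3` (`hd/R1/D0{0..1}`: entries `y₀−y₁, y₁−y₂, y₂−y₅`). [folklore] -/
theorem quadForm_lim3 (x : Fin 2 → ℝ) :
    star x ⬝ᵥ (redE EBlim 3 2 10878 y *ᵥ x) =
      x 0 * x 0 * (y 0 - y 1) + x 0 * x 1 * (y 1 - y 2) + x 1 * x 0 * (y 1 - y 2) + x 1 * x 1 * (y 2 - y 5) := by
  simp [dotProduct, mulVec, Fin.sum_univ_two, redE_apply, Sparse.ent, entU, EBlim, evalComb_cons, evalComb_nil]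
  ring

/-- Quadratic form of appendix block `4` (`hd/R1/D1{0..1}`: entries `y₁−y₂, y₂−y₅, y₅−y₂₇`). [folklore] -/
theorem quadForm_lim4 (x : Fin 2 → ℝ) :
    star x ⬝ᵥ (redE EBlim 4 2 10878 y *ᵥ x) =
      x 0 * x 0 * (y 1 - y 2) + x 0 * x 1 * (y 2 - y 5) + x 1 * x 0 * (y 2 - y 5) + x 1 * x 1 * (y 5 - y 27) := by
  simp [dotProduct, mulVec, Fin.sum_univ_two, redE_apply, Sparse.ent, entU, EBlim, evalComb_cons, evalComb_nil]
  ring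

end Forms

/-! ## The five appendix blocks are PSD at the class-LIMIT variables -/

variable {β : ℝ} {Lk : ℕ → ℕ} {μ : Measure (LGConfig 4 (SU 2))}

/-- Appendix block `0` (`hankel-site/R1/S0-2`) is PSD at `yLim μ` (tree `limObj_hankelSite_R1`; any real `β`). [folklore] -/
theorem limBlock0_posSemidef_yLim (hmono : StrictMono Lk) (heven : ∀ k, Even (Lk k + 1))
    (hμ : IsInfiniteVolumeLimitAlong (suRep 2) (β / (2 : ℕ)) Lk μ) : (redE EBlim 0 3 10878 (yLim μ)).PosSemidef :=
  Matrix.PosSemidef.of_dotProduct_mulVec_nonneg (redE_isHermitian _ _ _ _ _) fun x => by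
    rw [quadForm_lim0]; exact limObj_hankelSite_R1 hmono heven hμ (x 0) (x 1) (x 2)

/-- Appendix block `1` (`hankel-site/R2/S0-1`) is PSD at `yLim μ`. [folklore] -/
theorem limBlock1_posSemidef_yLim (hmono : StrictMono Lk) (heven : ∀ k, Even (Lk k + 1))
    (hμ : IsInfiniteVolumeLimitAlong (suRep 2) (β / (2 : ℕ)) Lk μ) : (redE EBlim 1 2 10878 (yLim μ)).PosSemidef :=
  Matrix.PosSemidef.of_dotProduct_mulVec_nonneg (redE_isHermitian _ _ _ _ _) fun x => by
    rw [quadForm_lim1]; exact limObj_hankelSite_R2 hmono heven hμ (x 0) (x 1)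

/-- Appendix block `2` (`hankel-link/R1/S0-1`) is PSD at `yLim μ` (`β_std ≥ 0`). [folklore] -/
theorem limBlock2_posSemidef_yLim (hβ : 0 ≤ β) (hmono : StrictMono Lk) (heven : ∀ k, Even (Lk k + 1))
    (hμ : IsInfiniteVolumeLimitAlong (suRep 2) (β / (2 : ℕ)) Lk μ) : (redE EBlim 2 2 10878 (yLim μ)).PosSemidef :=
  Matrix.PosSemidef.of_dotProduct_mulVec_nonneg (redE_isHermitian _ _ _ _ _) fun x => by
    rw [quadForm_lim2]; exact limObj_hankelLink_R1 hβ hmono heven hμ (x 0) (x 1)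

/-- Appendix block `3` (`hd/R1/D0{0..1}`) is PSD at `yLim μ` (`β_std ≥ 0`). [folklore] -/
theorem limBlock3_posSemidef_yLim (hβ : 0 ≤ β) (hmono : StrictMono Lk) (heven : ∀ k, Even (Lk k + 1))
    (hμ : IsInfiniteVolumeLimitAlong (suRep 2) (β / (2 : ℕ)) Lk μ) : (redE EBlim 3 2 10878 (yLim μ)).PosSemidef :=
  Matrix.PosSemidef.of_dotProduct_mulVec_nonneg (redE_isHermitian _ _ _ _ _) fun x => by
    rw [quadForm_lim3]; exact limObj_hankelDiff_D0 hβ hmono heven hμ (x 0) (x 1)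

/-- Appendix block `4` (`hd/R1/D1{0..1}`) is PSD at `yLim μ` (`β_std ≥ 0`). [folklore] -/
theorem limBlock4_posSemidef_yLim (hβ : 0 ≤ β) (hmono : StrictMono Lk) (heven : ∀ k, Even (Lk k + 1))
    (hμ : IsInfiniteVolumeLimitAlong (suRep 2) (β / (2 : ℕ)) Lk μ) : (redE EBlim 4 2 10878 (yLim μ)).PosSemidef :=
  Matrix.PosSemidef.of_dotProduct_mulVec_nonneg (redE_isHermitian _ _ _ _ _) fun x => by
    rw [quadForm_lim4]; exact limObj_hankelDiff_D1 hβ hmono heven hμ (x 0) (x 1)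

/-- **THE FIVE CLASS-LIMIT BLOCKS ARE PSD AT `yLim μ`** for every limit point along even tori (`β_std ≥ 0`), in the
`redE EBlim t (dimLlim.getD t 0)` form consumed by `KZL2rpD4LIM.posSemidef_all`. [folklore] -/
theorem limBlocks_posSemidef_yLim (hβ : 0 ≤ β) (hmono : StrictMono Lk) (heven : ∀ k, Even (Lk k + 1))
    (hμ : IsInfiniteVolumeLimitAlong (suRep 2) (β / (2 : ℕ)) Lk μ) :
    ∀ t : Fin 5, (redE EBlim t.val (dimLlim.getD t.val 0) 10878 (yLim μ)).PosSemidef := by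
  intro t
  match t with
  | ⟨0, _⟩ => exact limBlock0_posSemidef_yLim hmono heven hμ
  | ⟨1, _⟩ => exact limBlock1_posSemidef_yLim hmono heven hμ
  | ⟨2, _⟩ => exact limBlock2_posSemidef_yLim hβ hmono heven hμ
  | ⟨3, _⟩ => exact limBlock3_posSemidef_yLim hβ hmono heven hμ
  | ⟨4, _⟩ => exact limBlock4_posSemidef_yLim hβ hmono heven hμ

/-- **ALL 75 PSD HYPOTHESES OF A kz-L2-rp-4D CLASS-LIMIT CERTIFICATE HALF HOLD AT `yLim μ`** (every limit point along even tori,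
`β_std ≥ 0`): the 70 blocks of record by `redBlock_posSemidef_yLim` (file `ClassAFeasibleAtLimitKZL2rp` is NOT imported here to keep this
module light — the caller supplies them), the five appendix blocks by `limBlocks_posSemidef_yLim`. [folklore] -/
theorem posSemidef_all_yLim (hβ : 0 ≤ β) (hmono : StrictMono Lk) (heven : ∀ k, Even (Lk k + 1))
    (hμ : IsInfiniteVolumeLimitAlong (suRep 2) (β / (2 : ℕ)) Lk μ)
    (h70 : ∀ k : Fin 70, (redE KZL2rpD4.EB k.val (KZL2rpD4.dimL.getD k.val 0) 10878 (yLim μ)).PosSemidef) :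
    ∀ k : Fin 75, (redE KZL2rpD4LIM.EB k.val (KZL2rpD4LIM.dimL.getD k.val 0) 10878 (yLim μ)).PosSemidef :=
  KZL2rpD4LIM.posSemidef_all h70 (limBlocks_posSemidef_yLim hβ hmono heven hμ)

end Summit.QuantumFields.YangMills.Theorems.Instrument

end
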